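import Summits.Ventures.PercRepro.ExcessOneNonTightening

/-!
# Adjoining sets at a non-tightening direction ((F7) of Addendum 37)

Dossier proofs/MINE1-theoremS.md, Addendum 37 (F7), and proofs/MINE1-RSTARM-PROOF.md §1 (F7).
Let `a` be a non-tightening direction of `F` with nonempty partner family `K = partner a F`
(Theorem (NT), ExcessOneNonTightening.lean), and let `S` be a family of sets avoiding `a` such that
`y \ s` is a difference of `F` for every member `y ∋ a` and every `s ∈ S`. Then `a` is a
non-tightening direction of `F ∪ S` with the SAME partner family (`nonTightening_union`,
`partner_union_eq`): the `a`-edges of `(F ∪ S) \\ (F ∪ S)` are those of `F \\ F` (the new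
differences through `a` are the `y \ s`, already old), `F \\ F` is closed under removing `a`
((NT)(3), `erase_mem_diffs_of_mem_diffs`), and Marica–Schönheim on the larger partner family
pins it to `K`. Consequently Theorem (NT)(2) applies to the adjoined sets: every `s ∈ S` has
`s ∩ Rstar K ∈ K` (`inter_Rstar_mem_partner_of_adjoin`).

In the instance of Theorem (R*-M) the hypothesis holds for every `S ⊆ U` avoiding `a`, because
`y \ s ⊆ y` is a face and `y \ s ⊆ univ \ s ∈ L'`, so `y \ s ∈ L' ∩ C = F \\ F` in the residue
case; with `S = {u}` this is `u ∩ ρ_m ∈ K_m`, with `S = {z}` (a minimal member of `U` inside `u`)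
it gives `z ∩ R_m ∈ K_m`, hence `z ∈ K_m` and `z ⊆ R_m` — the steps (F7) and Addendum 39 (1a).
-/

namespace PercRepro.MSTight

open Finset
open scoped FinsetFamily

variable {α : Type*} [DecidableEq α] [Fintype α] {a : α} {F S : Finset (Finset α)}

omit [Fintype α] in
/-- The `a`-edges of `(F ∪ S) \\ (F ∪ S)` are those of `F \\ F` when the sets of `S` avoid `a`
and every `y \ s` (`a ∈ y ∈ F`, `s ∈ S`) is already a difference of `F`. -/
theorem diffsY_union_eq (hS : ∀ s ∈ S, a ∉ s)
    (hdiff : ∀ s ∈ S, ∀ y ∈ F, a ∈ y → y \ s ∈ F \\ F) :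
    diffsY a (F ∪ S) = diffsY a F := by
  ext E
  rw [mem_diffsY_iff, mem_diffsY_iff]
  constructor
  · rintro ⟨haE, hE⟩
    refine ⟨haE, ?_⟩
    obtain ⟨p, hp, q, hq, hpq⟩ := mem_diffs.1 hE
    have hap : a ∈ p := by
      have : a ∈ p \ q := by rw [hpq]; exact mem_insert_self a E
      exact (mem_sdiff.1 this).1
    have hpF : p ∈ F := by
      rcases mem_union.1 hp with h | h
      · exact h
      · exact absurd hap (hS p h)
    rcases mem_union.1 hq with hqF | hqS
    · rw [← hpq]
      exact mem_diffs.2 ⟨p, hpF, q, hqF, rfl⟩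
    · rw [← hpq]
      exact hdiff q hqS p hpF hap
  · rintro ⟨haE, hE⟩
    exact ⟨haE, diffs_mono_self subset_union_left hE⟩

/-- At a non-tightening direction `diffsY a F ⊆ diffsX a F` (the difference family is closed
under removing `a`, (NT)(3)); the tree's `diffsY_subset_diffsX` assumes a down-set instead. -/
theorem diffsY_subset_diffsX_of_nonTightening (hε : (diffsX a F ∩ diffsY a F).card = (partner a F).card)
    (hK : (partner a F).Nonempty) : diffsY a F ⊆ diffsX a F := by
  intro E hE
  obtain ⟨haE, hE'⟩ := mem_diffsY_iff.1 hE
  have h := erase_mem_diffs_of_mem_diffs hε hK hE'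
  rw [erase_insert haE] at h
  exact mem_diffsX_iff.2 ⟨h, haE⟩

omit [Fintype α] in
/-- The partner family of `F` is contained in the partner family of `F ∪ S`. -/
theorem partner_subset_partner_union (a : α) (F S : Finset (Finset α)) :
    partner a F ⊆ partner a (F ∪ S) := by
  intro t ht
  rw [mem_partner_iff] at ht ⊢
  exact ⟨mem_union_left _ ht.1, ht.2.1, mem_union_left _ ht.2.2⟩

/-- **(F7, the mechanism).** Adjoining sets avoiding `a` whose differences with the members through
`a` are old differences keeps `a` non-tightening, with the same partner family. -/
theorem nonTightening_union (hε : (diffsX a F ∩ diffsY a F).card = (partner a F).card)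
    (hK : (partner a F).Nonempty) (hS : ∀ s ∈ S, a ∉ s)
    (hdiff : ∀ s ∈ S, ∀ y ∈ F, a ∈ y → y \ s ∈ F \\ F) :
    partner a (F ∪ S) = partner a F ∧
      (diffsX a (F ∪ S) ∩ diffsY a (F ∪ S)).card = (partner a (F ∪ S)).card := by
  -- the `a`-edges of the larger difference family are the old ones
  have hY := diffsY_union_eq hS hdiff
  have hYX : diffsY a F ⊆ diffsX a F := diffsY_subset_diffsX_of_nonTightening hε hK
  have hXX : diffsX a F ⊆ diffsX a (F ∪ S) := by
    intro E hE
    rw [mem_diffsX_iff] at hE ⊢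
    exact ⟨diffs_mono_self subset_union_left hE.1, hE.2⟩
  have e1 : diffsX a (F ∪ S) ∩ diffsY a (F ∪ S) = diffsY a F := by
    rw [hY]
    exact inter_eq_right.2 (hYX.trans hXX)
  have e2 : diffsX a F ∩ diffsY a F = diffsY a F := inter_eq_right.2 hYX
  have hcard : (diffsX a (F ∪ S) ∩ diffsY a (F ∪ S)).card = (partner a F).card := by
    rw [e1, ← e2, hε]
  -- the larger partner family is pinned by Marica–Schönheim
  have hsub := partner_subset_partner_union a F S
  have hle : (partner a (F ∪ S)).card ≤ (partner a F).card := by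
    calc (partner a (F ∪ S)).card
        ≤ (partner a (F ∪ S) \\ partner a (F ∪ S)).card := card_le_card_diffs _
      _ ≤ (diffsX a (F ∪ S) ∩ diffsY a (F ∪ S)).card := card_le_card (diffs_partner_subset _ _)
      _ = (partner a F).card := hcard
  have heq : partner a (F ∪ S) = partner a F := (eq_of_subset_of_card_le hsub hle).symm
  exact ⟨heq, by rw [hcard, heq]⟩

/-- **(F7).** Every adjoined set `s ∈ S` meets the addable part of `K = partner a F` in a partner
member: `s ∩ Rstar K ∈ K`. -/
theorem inter_Rstar_mem_partner_of_adjoin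
    (hε : (diffsX a F ∩ diffsY a F).card = (partner a F).card)
    (hK : (partner a F).Nonempty) (hS : ∀ s ∈ S, a ∉ s)
    (hdiff : ∀ s ∈ S, ∀ y ∈ F, a ∈ y → y \ s ∈ F \\ F) {s : Finset α} (hs : s ∈ S) :
    s ∩ Rstar (partner a F) ∈ partner a F := by
  obtain ⟨heq, hε'⟩ := nonTightening_union hε hK hS hdiff
  have hK' : (partner a (F ∪ S)).Nonempty := by rw [heq]; exact hK
  have hs0 : s ∈ part0 a (F ∪ S) := mem_part0.2 ⟨mem_union_right _ hs, hS s hs⟩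
  have h := inter_Rstar_mem_partner hε' hK' hs0
  rwa [heq] at h

/-- **(F7, the minimal members).** If moreover `s` is minimal among the sets of `S ∪ partner a F`
in the sense that no partner member is a proper subset of `s`, then `s` itself is a partner member
and `s ⊆ Rstar (partner a F)`. -/
theorem mem_partner_and_subset_Rstar_of_adjoin_of_minimal
    (hε : (diffsX a F ∩ diffsY a F).card = (partner a F).card)
    (hK : (partner a F).Nonempty) (hS : ∀ s ∈ S, a ∉ s)
    (hdiff : ∀ s ∈ S, ∀ y ∈ F, a ∈ y → y \ s ∈ F \\ F) {s : Finset α} (hs : s ∈ S)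
    (hmin : ∀ k ∈ partner a F, k ⊆ s → k = s) :
    s ∈ partner a F ∧ s ⊆ Rstar (partner a F) := by
  have h := inter_Rstar_mem_partner_of_adjoin hε hK hS hdiff hs
  have e : s ∩ Rstar (partner a F) = s := hmin _ h inter_subset_left
  refine ⟨by rwa [e] at h, ?_⟩
  rw [← e]
  exact inter_subset_right

end PercRepro.MSTight
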